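import Summits.QuantumFields.YangMills.Theorems.FemtoTransferGapPositivityGram
import HarnessLib

/-!
# THE (B-ST) DOOR: ground-state identity; upper quasimode + Poincaré inequality ⇒ stiff bound; Poincaré inequalities transfer under ONE-SIDED
# kernel lower bounds (lane A of S-BASE, crux `TwistedTraceScaling` stmt-QuantumFields-20203, C4-CORE, the (B-ST) pen; design card
# `pub/ym-fleet/ym-luscher-20007-p1/Lines-BST-poincare.md`)

The stability brick (B-ST) of `RecordAnalyticInput` (`hST` of `…BORecordInputOfST.recordAnalyticInput_of_hST`) asks, for test functions `v` fibrewise `w`-orthogonal to the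
profile of record, `T(v) ≤ (1 − θ₀)·Λ·‖v‖²_w` for SOME fixed `θ₀ ∈ (0,1]` (any positive `θ₀` closes the record: `hb_small` is `∀ a > 0`).  Because only `θ₀ > 0` is needed, the
two-sided Laplace asymptotics of the averaged kernel that a gap NEAR THE CEILING would require (`…Negative.StiffGapNotFromDomination` R35, `…Negative.StiffGapCeiling` R60) can be
replaced by the GROUND-STATE REPRESENTATION, in which a spectral gap is a POINCARÉ INEQUALITY, and Poincaré inequalities are monotone under one-sided comparison.  This file is
the abstract door (any finite measure space `(X, μ)`, bounded measurable data, a symmetric kernel `M`):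
* §1 ★★ `groundState_identity` — `∫∫ (gΘ)(x) M(x,y) (gΘ)(y) = ∫ g² Θ·(MΘ) − ½ ∫∫ (g(x) − g(y))²·Θ(x)M(x,y)Θ(y)` (algebra + Fubini);
* §2 ★★★ `form_le_of_quasimode_of_poincare` — if on the support `S` of `g` the profile `Θ ≥ 0` is an UPPER quasimode, `(MΘ)(x) ≤ (1+η)·Λ·Θ(x)w(x)`, and the jump form
  `½∫∫(g−g')²ΘMΘ` dominates `Λ/P` times the `Θ²w`-variance of `g` on `S`, then `∫∫ (gΘ)M(gΘ) ≤ Λ·[(1 + η − 1/P)·∫ g²Θ²w + (1/P)·(∫ gΘ²w)²/∫_S Θ²w]` — the stiff bound with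
  `1 − θ₀ = 1 + η − 1/P` and the (almost-)orthogonality defect explicit;
* §3 ★★ `variance_le_of_comparison` — the Poincaré inequality TRANSFERS: if `Θ²w ≤ C_ν·D` on `S`, `c_J·J₀ ≤ ΘMΘ` everywhere (`c_J > 0`; `J₀` the flat jump kernel, put to `0` off
  `S × S`) and the flat pair `(D, J₀)` satisfies a Poincaré inequality on `S` with constant `P₀` for `g`, then `(Θ²w, ΘMΘ)` satisfies it with constant `C_ν·P₀/c_J` — ONE-SIDED kernel
  information suffices (contrast R35: one-sided domination from ABOVE transfers nothing; domination of the JUMP kernel from BELOW transfers the gap, at the price of the constant);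
* §4 ★★★ `form_le_of_quasimode_of_comparison` — §2 ∘ §3: the shape consumed by the (B-ST) assembly with `M` = the based-averaged tube kernel, `Θ = Ω_c`, `w = softWeight χ`,
  `Λ` = the record's `σ·λ₀`, `(D, J₀)` = the flat Mehler model whose `1/P₀` is `θ_S(L) = 1 − mehlerRatio g₀(L)`; `θ₀ = c_J/(C_ν P₀) − η`.
No `β`, no lattice: the analytic inputs (quasimode upper bound = the (OD) pen's central quasimode in record currency; the kernel lower bound by restricting the based gauge integral to a
ball; the flat Poincaré inequality from `…MehlerGap.mehlerForm_le_gap`) are separate files.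
HONEST FRAMING: measure-theoretic bookkeeping for a stub of a child of the CONDITIONAL route R2b1; (B-ST) OPEN; C4-CORE OPEN; not infinite volume, not a gap, not Clay.

## References
* B. Helffer, *Spectral Theory and its Applications*, CUP 2013, Lemma 7.1 and §7 (ground-state representation). [Helffer2013]
-/

set_option autoImplicit false

noncomputable section

open MeasureTheory

namespace Summit.QuantumFields.YangMills.Theorems.FemtoTransferGap.StiffDoor

variable {X : Type*} [MeasurableSpace X] {μ : Measure X} [IsFiniteMeasure μ]

/-! ## §0 Integrability of bounded integrands -/

/-- A bounded measurable function of two variables is integrable on the (finite) product measure. [folklore] -/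
theorem integrable_prod_of_bdd {F : X → X → ℝ} (hF : Measurable (Function.uncurry F)) {C : ℝ} (hC : ∀ x y, |F x y| ≤ C) :
    Integrable (Function.uncurry F) (μ.prod μ) :=
  integrable_of_measurable_abs_le (μ.prod μ) hF (C := C) fun p => hC p.1 p.2

/-- Iterated integral = product integral for bounded measurable integrands. [folklore] -/
theorem integral_integral_eq_prod {F : X → X → ℝ} (hF : Measurable (Function.uncurry F)) {C : ℝ} (hC : ∀ x y, |F x y| ≤ C) :
    ∫ x, ∫ y, F x y ∂μ ∂μ = ∫ p, F p.1 p.2 ∂(μ.prod μ) :=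
  (integral_prod (fun p : X × X => F p.1 p.2) (integrable_prod_of_bdd hF hC)).symm

/-- The partial integral `x ↦ ∫ F(x,y) dy` of a bounded measurable `F` is measurable and bounded by `C·μ(X)`. [folklore] -/
theorem measurable_integral_right_of_bdd {F : X → X → ℝ} (hF : Measurable (Function.uncurry F)) {C : ℝ} (hC : ∀ x y, |F x y| ≤ C) :
    Measurable (fun x => ∫ y, F x y ∂μ) ∧ ∀ x, |∫ y, F x y ∂μ| ≤ C * μ.real Set.univ := by
  refine ⟨(hF.stronglyMeasurable.integral_prod_right' (ν := μ)).measurable, fun x => ?_⟩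
  have h := norm_integral_le_of_norm_le_const (μ := μ) (f := fun y => F x y) (C := C) (Filter.Eventually.of_forall fun y => by
    rw [Real.norm_eq_abs]; exact hC x y)
  rw [Real.norm_eq_abs] at h
  linarith [mul_comm C (μ.real Set.univ)]

/-! ## §1 ★★ The ground-state identity -/

section Identity

variable {M : X → X → ℝ} {Θ g : X → ℝ} {CM CΘ Cg : ℝ}

/-- The four integrands are measurable. [folklore] -/
theorem measurable_integrands (hM : Measurable (Function.uncurry M)) (hΘ : Measurable Θ) (hg : Measurable g) :
    Measurable (Function.uncurry fun x y => g x * Θ x * M x y * (g y * Θ y)) ∧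
      Measurable (Function.uncurry fun x y => g x ^ 2 * Θ x * M x y * Θ y) ∧
      Measurable (Function.uncurry fun x y => g y ^ 2 * Θ x * M x y * Θ y) ∧
      Measurable (Function.uncurry fun x y => (g x - g y) ^ 2 * (Θ x * M x y * Θ y)) := by
  have h1 : Measurable fun p : X × X => g p.1 := hg.comp measurable_fst
  have h2 : Measurable fun p : X × X => g p.2 := hg.comp measurable_snd
  have h3 : Measurable fun p : X × X => Θ p.1 := hΘ.comp measurable_fst
  have h4 : Measurable fun p : X × X => Θ p.2 := hΘ.comp measurable_snd
  have hM' : Measurable fun p : X × X => M p.1 p.2 := hM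
  exact ⟨((h1.mul h3).mul hM').mul (h2.mul h4), (((h1.pow_const 2).mul h3).mul hM').mul h4, (((h2.pow_const 2).mul h3).mul hM').mul h4,
    ((h1.sub h2).pow_const 2).mul ((h3.mul hM').mul h4)⟩

omit [MeasurableSpace X] in
/-- Bounds for the four integrands. [folklore] -/
theorem abs_integrands_le (hMb : ∀ x y, |M x y| ≤ CM) (hΘb : ∀ x, |Θ x| ≤ CΘ) (hgb : ∀ x, |g x| ≤ Cg) (x y : X) :
    |g x * Θ x * M x y * (g y * Θ y)| ≤ Cg * CΘ * CM * (Cg * CΘ) ∧ |g x ^ 2 * Θ x * M x y * Θ y| ≤ Cg ^ 2 * CΘ * CM * CΘ ∧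
      |g y ^ 2 * Θ x * M x y * Θ y| ≤ Cg ^ 2 * CΘ * CM * CΘ ∧ |(g x - g y) ^ 2 * (Θ x * M x y * Θ y)| ≤ (2 * Cg) ^ 2 * (CΘ * CM * CΘ) := by
  have hCg : 0 ≤ Cg := (abs_nonneg _).trans (hgb x)
  have hCΘ : 0 ≤ CΘ := (abs_nonneg _).trans (hΘb x)
  have hCM : 0 ≤ CM := (abs_nonneg _).trans (hMb x y)
  have hgx := hgb x; have hgy := hgb y; have hΘx := hΘb x; have hΘy := hΘb y; have hMxy := hMb x y
  have hsq : ∀ z, |g z ^ 2| ≤ Cg ^ 2 := fun z => by rw [abs_pow]; exact pow_le_pow_left₀ (abs_nonneg _) (hgb z) 2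
  have hdiff : |(g x - g y) ^ 2| ≤ (2 * Cg) ^ 2 := by
    rw [abs_pow]; refine pow_le_pow_left₀ (abs_nonneg _) ?_ 2
    exact (abs_sub _ _).trans (by linarith)
  have hK : |Θ x * M x y * Θ y| ≤ CΘ * CM * CΘ := by
    rw [abs_mul, abs_mul]; exact mul_le_mul (mul_le_mul hΘx hMxy (abs_nonneg _) hCΘ) hΘy (abs_nonneg _) (mul_nonneg hCΘ hCM)
  refine ⟨?_, ?_, ?_, ?_⟩
  · rw [abs_mul, abs_mul, abs_mul, abs_mul]
    exact mul_le_mul (mul_le_mul (mul_le_mul hgx hΘx (abs_nonneg _) hCg) hMxy (abs_nonneg _) (mul_nonneg hCg hCΘ))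
      (mul_le_mul hgy hΘy (abs_nonneg _) hCg) (by positivity) (by positivity)
  · rw [abs_mul, abs_mul, abs_mul]
    exact mul_le_mul (mul_le_mul (mul_le_mul (hsq x) hΘx (abs_nonneg _) (by positivity)) hMxy (abs_nonneg _) (by positivity)) hΘy (abs_nonneg _)
      (by positivity)
  · rw [abs_mul, abs_mul, abs_mul]
    exact mul_le_mul (mul_le_mul (mul_le_mul (hsq y) hΘx (abs_nonneg _) (by positivity)) hMxy (abs_nonneg _) (by positivity)) hΘy (abs_nonneg _)
      (by positivity)
  · rw [abs_mul]; exact mul_le_mul hdiff hK (abs_nonneg _) (by positivity)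

/-- ★★ **THE GROUND-STATE IDENTITY.**  For a symmetric bounded measurable kernel `M` and bounded measurable `Θ, g` on a finite measure space:
`∫∫ (gΘ)(x) M(x,y) (gΘ)(y) = ∫ g(x)²Θ(x)·(∫ M(x,y)Θ(y) dy) dx − ½ ∫∫ (g(x) − g(y))² Θ(x)M(x,y)Θ(y)`. [cite: Helffer2013, §7] -/
theorem groundState_identity (hM : Measurable (Function.uncurry M)) (hMb : ∀ x y, |M x y| ≤ CM) (hsymm : ∀ x y, M x y = M y x)
    (hΘ : Measurable Θ) (hΘb : ∀ x, |Θ x| ≤ CΘ) (hg : Measurable g) (hgb : ∀ x, |g x| ≤ Cg) :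
    ∫ x, ∫ y, (g x * Θ x) * M x y * (g y * Θ y) ∂μ ∂μ =
      (∫ x, g x ^ 2 * Θ x * (∫ y, M x y * Θ y ∂μ) ∂μ) - (1 / 2) * ∫ x, ∫ y, (g x - g y) ^ 2 * (Θ x * M x y * Θ y) ∂μ ∂μ := by
  obtain ⟨m1, m2, m3, m4⟩ := measurable_integrands hM hΘ hg
  have b := fun x y => abs_integrands_le (M := M) hMb hΘb hgb x y
  have e1 := integral_integral_eq_prod (μ := μ) m1 (C := Cg * CΘ * CM * (Cg * CΘ)) fun x y => (b x y).1
  have e2 := integral_integral_eq_prod (μ := μ) m2 (C := Cg ^ 2 * CΘ * CM * CΘ) fun x y => (b x y).2.1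
  have e4 := integral_integral_eq_prod (μ := μ) m4 (C := (2 * Cg) ^ 2 * (CΘ * CM * CΘ)) fun x y => (b x y).2.2.2
  have i1 := integrable_prod_of_bdd (μ := μ) m1 (C := Cg * CΘ * CM * (Cg * CΘ)) fun x y => (b x y).1
  have i2 := integrable_prod_of_bdd (μ := μ) m2 (C := Cg ^ 2 * CΘ * CM * CΘ) fun x y => (b x y).2.1
  have i3 := integrable_prod_of_bdd (μ := μ) m3 (C := Cg ^ 2 * CΘ * CM * CΘ) fun x y => (b x y).2.2.1
  -- the middle term as a double integral
  have emid : (∫ x, g x ^ 2 * Θ x * (∫ y, M x y * Θ y ∂μ) ∂μ) = ∫ x, ∫ y, g x ^ 2 * Θ x * M x y * Θ y ∂μ ∂μ := by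
    refine integral_congr_ae (ae_of_all _ fun x => ?_)
    dsimp only
    rw [← integral_const_mul]
    refine integral_congr_ae (ae_of_all _ fun y => ?_); dsimp only; ring
  -- the swapped middle term equals the middle term (symmetry of `M`)
  have eswap : ∫ p, Function.uncurry (fun x y => g y ^ 2 * Θ x * M x y * Θ y) p ∂(μ.prod μ) = ∫ p, Function.uncurry (fun x y => g x ^ 2 * Θ x * M x y * Θ y) p ∂(μ.prod μ) := by
    rw [← integral_prod_swap (μ := μ) (ν := μ) (Function.uncurry fun x y => g x ^ 2 * Θ x * M x y * Θ y)]
    refine integral_congr_ae (ae_of_all _ fun p => ?_)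
    simp only [Function.uncurry, Prod.swap]
    rw [hsymm p.2 p.1]; ring
  -- expand the jump integrand on the product
  have eexp : ∫ p, Function.uncurry (fun x y => (g x - g y) ^ 2 * (Θ x * M x y * Θ y)) p ∂(μ.prod μ) =
      (∫ p, Function.uncurry (fun x y => g x ^ 2 * Θ x * M x y * Θ y) p ∂(μ.prod μ)) +
        (∫ p, Function.uncurry (fun x y => g y ^ 2 * Θ x * M x y * Θ y) p ∂(μ.prod μ)) -
        2 * ∫ p, Function.uncurry (fun x y => g x * Θ x * M x y * (g y * Θ y)) p ∂(μ.prod μ) := by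
    have i23 : Integrable (fun p : X × X => Function.uncurry (fun x y => g x ^ 2 * Θ x * M x y * Θ y) p +
        Function.uncurry (fun x y => g y ^ 2 * Θ x * M x y * Θ y) p) (μ.prod μ) := i2.add i3
    have i1' : Integrable (fun p : X × X => 2 * Function.uncurry (fun x y => g x * Θ x * M x y * (g y * Θ y)) p) (μ.prod μ) := i1.const_mul 2
    have h1 : ∫ p, Function.uncurry (fun x y => (g x - g y) ^ 2 * (Θ x * M x y * Θ y)) p ∂(μ.prod μ) =
        ∫ p, ((Function.uncurry (fun x y => g x ^ 2 * Θ x * M x y * Θ y) p + Function.uncurry (fun x y => g y ^ 2 * Θ x * M x y * Θ y) p) -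
          2 * Function.uncurry (fun x y => g x * Θ x * M x y * (g y * Θ y)) p) ∂(μ.prod μ) :=
      integral_congr_ae (ae_of_all _ fun p => by simp only [Function.uncurry]; ring)
    rw [h1, integral_sub i23 i1', integral_add i2 i3, integral_const_mul]
  have e1' : ∫ x, ∫ y, (g x * Θ x) * M x y * (g y * Θ y) ∂μ ∂μ = ∫ p, Function.uncurry (fun x y => g x * Θ x * M x y * (g y * Θ y)) p ∂(μ.prod μ) := e1
  have e2' : ∫ x, ∫ y, g x ^ 2 * Θ x * M x y * Θ y ∂μ ∂μ = ∫ p, Function.uncurry (fun x y => g x ^ 2 * Θ x * M x y * Θ y) p ∂(μ.prod μ) := e2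
  have e4' : ∫ x, ∫ y, (g x - g y) ^ 2 * (Θ x * M x y * Θ y) ∂μ ∂μ = ∫ p, Function.uncurry (fun x y => (g x - g y) ^ 2 * (Θ x * M x y * Θ y)) p ∂(μ.prod μ) := e4
  rw [emid, e1', e2', e4', eexp, eswap]
  ring

end Identity

/-! ## §2 ★★★ Upper quasimode + Poincaré inequality ⇒ the stiff bound -/

section Stiff

variable {M : X → X → ℝ} {Θ g w : X → ℝ} {CM CΘ Cg Cw : ℝ} {S : Set X} {η Λ P : ℝ}

/-- The quasimode term: `∫ g²Θ·(MΘ) ≤ (1+η)·Λ·∫ g²Θ²w` when `(MΘ)(x) ≤ (1+η)ΛΘ(x)w(x)` on the support of `g` and `Θ ≥ 0`. [folklore] -/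
theorem quasimode_term_le (hM : Measurable (Function.uncurry M)) (hMb : ∀ x y, |M x y| ≤ CM) (hΘ : Measurable Θ) (hΘb : ∀ x, |Θ x| ≤ CΘ) (hΘ0 : ∀ x, 0 ≤ Θ x)
    (hg : Measurable g) (hgb : ∀ x, |g x| ≤ Cg) (hgS : ∀ x, x ∉ S → g x = 0) (hw : Measurable w) (hwb : ∀ x, |w x| ≤ Cw)
    (hq : ∀ x ∈ S, ∫ y, M x y * Θ y ∂μ ≤ (1 + η) * Λ * (Θ x * w x)) :
    (∫ x, g x ^ 2 * Θ x * (∫ y, M x y * Θ y ∂μ) ∂μ) ≤ (1 + η) * Λ * ∫ x, g x ^ 2 * (Θ x ^ 2 * w x) ∂μ := by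
  -- the partial integral is bounded measurable
  have hF : Measurable (Function.uncurry fun x y => M x y * Θ y) := hM.mul (hΘ.comp measurable_snd)
  have hFb : ∀ x y, |M x y * Θ y| ≤ CM * CΘ := fun x y => by
    rw [abs_mul]; exact mul_le_mul (hMb x y) (hΘb y) (abs_nonneg _) ((abs_nonneg _).trans (hMb x y))
  obtain ⟨hIm, hIb⟩ := measurable_integral_right_of_bdd (μ := μ) hF hFb
  have hsq : ∀ z, |g z ^ 2| ≤ Cg ^ 2 := fun z => by rw [abs_pow]; exact pow_le_pow_left₀ (abs_nonneg _) (hgb z) 2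
  have hL : Integrable (fun x => g x ^ 2 * Θ x * ∫ y, M x y * Θ y ∂μ) μ :=
    integrable_of_measurable_abs_le μ (((hg.pow_const 2).mul hΘ).mul hIm) (C := Cg ^ 2 * CΘ * (CM * CΘ * μ.real Set.univ)) fun x => by
      rw [abs_mul, abs_mul]
      exact mul_le_mul (mul_le_mul (hsq x) (hΘb x) (abs_nonneg _) (sq_nonneg _)) (hIb x) (abs_nonneg _) (mul_nonneg (sq_nonneg _) ((abs_nonneg _).trans (hΘb x)))
  have hR : Integrable (fun x => (1 + η) * Λ * (g x ^ 2 * (Θ x ^ 2 * w x))) μ := by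
    refine (integrable_of_measurable_abs_le μ (f := fun x => g x ^ 2 * (Θ x ^ 2 * w x)) (((hg.pow_const 2).mul ((hΘ.pow_const 2).mul hw)))
      (C := Cg ^ 2 * (CΘ ^ 2 * Cw)) fun x => ?_).const_mul _
    rw [abs_mul, abs_mul, abs_pow (Θ x)]
    exact mul_le_mul (hsq x) (mul_le_mul (pow_le_pow_left₀ (abs_nonneg _) (hΘb x) 2) (hwb x) (abs_nonneg _) (sq_nonneg _)) (by positivity) (sq_nonneg _)
  rw [← integral_const_mul]
  refine integral_mono hL hR fun x => ?_
  dsimp only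
  by_cases hx : x ∈ S
  · have h1 := hq x hx
    have h2 : 0 ≤ g x ^ 2 * Θ x := mul_nonneg (sq_nonneg _) (hΘ0 x)
    calc g x ^ 2 * Θ x * ∫ y, M x y * Θ y ∂μ ≤ g x ^ 2 * Θ x * ((1 + η) * Λ * (Θ x * w x)) := mul_le_mul_of_nonneg_left h1 h2
      _ = (1 + η) * Λ * (g x ^ 2 * (Θ x ^ 2 * w x)) := by ring
  · simp [hgS x hx]

/-- ★★★ **THE STIFF BOUND FROM AN UPPER QUASIMODE AND A POINCARÉ INEQUALITY.**  `M` symmetric bounded measurable, `Θ, g, w` bounded measurable, `Θ ≥ 0`, `g = 0` off `S`.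
If `(MΘ)(x) ≤ (1+η)·Λ·Θ(x)w(x)` for `x ∈ S` (upper quasimode on the support) and the jump form dominates `Λ/P` times the `Θ²w`-variance of `g`,
`Λ·(∫ g²Θ²w − (∫ gΘ²w)²/Z) ≤ P·½∫∫(g(x)−g(y))²Θ(x)M(x,y)Θ(y)` (`Z = ∫_S Θ²w`, `P > 0`), then
`∫∫ (gΘ)M(gΘ) ≤ Λ·[(1 + η − 1/P)·∫ g²Θ²w + (1/P)·(∫ gΘ²w)²/Z]`. [cite: Helffer2013, §7] -/
theorem form_le_of_quasimode_of_poincare (hM : Measurable (Function.uncurry M)) (hMb : ∀ x y, |M x y| ≤ CM) (hsymm : ∀ x y, M x y = M y x)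
    (hΘ : Measurable Θ) (hΘb : ∀ x, |Θ x| ≤ CΘ) (hΘ0 : ∀ x, 0 ≤ Θ x) (hg : Measurable g) (hgb : ∀ x, |g x| ≤ Cg) (hgS : ∀ x, x ∉ S → g x = 0)
    (hw : Measurable w) (hwb : ∀ x, |w x| ≤ Cw)
    (hq : ∀ x ∈ S, ∫ y, M x y * Θ y ∂μ ≤ (1 + η) * Λ * (Θ x * w x)) (hP : 0 < P)
    (hPoinc : Λ * ((∫ x, g x ^ 2 * (Θ x ^ 2 * w x) ∂μ) - (∫ x, g x * (Θ x ^ 2 * w x) ∂μ) ^ 2 / ∫ x in S, Θ x ^ 2 * w x ∂μ) ≤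
      P * ((1 / 2) * ∫ x, ∫ y, (g x - g y) ^ 2 * (Θ x * M x y * Θ y) ∂μ ∂μ)) :
    ∫ x, ∫ y, (g x * Θ x) * M x y * (g y * Θ y) ∂μ ∂μ ≤
      Λ * ((1 + η - 1 / P) * ∫ x, g x ^ 2 * (Θ x ^ 2 * w x) ∂μ + (1 / P) * ((∫ x, g x * (Θ x ^ 2 * w x) ∂μ) ^ 2 / ∫ x in S, Θ x ^ 2 * w x ∂μ)) := by
  rw [groundState_identity (μ := μ) hM hMb hsymm hΘ hΘb hg hgb]
  have hmid := quasimode_term_le (μ := μ) (η := η) (Λ := Λ) hM hMb hΘ hΘb hΘ0 hg hgb hgS hw hwb hq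
  set N := ∫ x, g x ^ 2 * (Θ x ^ 2 * w x) ∂μ
  set m := ∫ x, g x * (Θ x ^ 2 * w x) ∂μ
  set Z := ∫ x in S, Θ x ^ 2 * w x ∂μ
  set D := ∫ x, ∫ y, (g x - g y) ^ 2 * (Θ x * M x y * Θ y) ∂μ ∂μ
  have h2 : Λ * (N - m ^ 2 / Z) / P ≤ (1 / 2) * D := by
    rw [div_le_iff₀ hP]; linarith [hPoinc]
  have key : (∫ x, g x ^ 2 * Θ x * (∫ y, M x y * Θ y ∂μ) ∂μ) - (1 / 2) * D ≤ (1 + η) * Λ * N - Λ * (N - m ^ 2 / Z) / P := by linarith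
  refine key.trans (le_of_eq ?_)
  field_simp
  ring

end Stiff

/-! ## §3 ★★ Transfer of the Poincaré inequality under one-sided comparison -/

section Comparison

variable {M J₀ : X → X → ℝ} {Θ g w D : X → ℝ} {CM CΘ Cg Cw CD CJ : ℝ} {S : Set X} {Cν cJ P₀ : ℝ}

/-- Set integrals of bounded measurable functions on a finite measure are integrals of integrable functions. [folklore] -/
theorem integrableOn_of_bdd {f : X → ℝ} (hf : Measurable f) {C : ℝ} (hC : ∀ x, |f x| ≤ C) : Integrable f (μ.restrict S) :=
  integrable_of_measurable_abs_le (μ.restrict S) hf hC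

/-- The variance is the least mean square deviation: `∫_S g²ν − (∫_S gν)²/∫_S ν ≤ ∫_S (g − a)²ν` for every constant `a` (`ν = ρ·μ`, `ρ ≥ 0`, `∫_S ρ > 0`). [folklore] -/
theorem variance_le_sq_dev {ρ : X → ℝ} (hρ : Measurable ρ) {Cρ : ℝ} (hρb : ∀ x, |ρ x| ≤ Cρ) (hg : Measurable g) (hgb : ∀ x, |g x| ≤ Cg)
    (hZ : 0 < ∫ x in S, ρ x ∂μ) (a : ℝ) :
    (∫ x in S, g x ^ 2 * ρ x ∂μ) - (∫ x in S, g x * ρ x ∂μ) ^ 2 / (∫ x in S, ρ x ∂μ) ≤ ∫ x in S, (g x - a) ^ 2 * ρ x ∂μ := by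
  set Z := ∫ x in S, ρ x ∂μ
  set N := ∫ x in S, g x ^ 2 * ρ x ∂μ
  set m := ∫ x in S, g x * ρ x ∂μ
  have hsq : ∀ z, |g z ^ 2| ≤ Cg ^ 2 := fun z => by rw [abs_pow]; exact pow_le_pow_left₀ (abs_nonneg _) (hgb z) 2
  have hCg : ∀ z, 0 ≤ Cg := fun z => (abs_nonneg _).trans (hgb z)
  have iN : Integrable (fun x => g x ^ 2 * ρ x) (μ.restrict S) := integrableOn_of_bdd ((hg.pow_const 2).mul hρ) (C := Cg ^ 2 * Cρ) fun x => by
    rw [abs_mul]; exact mul_le_mul (hsq x) (hρb x) (abs_nonneg _) (sq_nonneg _)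
  have im : Integrable (fun x => g x * ρ x) (μ.restrict S) := integrableOn_of_bdd (hg.mul hρ) (C := Cg * Cρ) fun x => by
    rw [abs_mul]; exact mul_le_mul (hgb x) (hρb x) (abs_nonneg _) (hCg x)
  have iZ : Integrable ρ (μ.restrict S) := integrableOn_of_bdd hρ hρb
  have hexp : ∫ x in S, (g x - a) ^ 2 * ρ x ∂μ = N - 2 * a * m + a ^ 2 * Z := by
    have e : ∫ x in S, (g x - a) ^ 2 * ρ x ∂μ = ∫ x in S, ((g x ^ 2 * ρ x - (2 * a) * (g x * ρ x)) + a ^ 2 * ρ x) ∂μ :=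
      integral_congr_ae (ae_of_all _ fun x => by ring)
    have i1 : Integrable (fun x => g x ^ 2 * ρ x - (2 * a) * (g x * ρ x)) (μ.restrict S) := iN.sub (im.const_mul _)
    have i2 : Integrable (fun x => a ^ 2 * ρ x) (μ.restrict S) := iZ.const_mul _
    rw [e, integral_add i1 i2, integral_sub iN (im.const_mul _), integral_const_mul, integral_const_mul]
  rw [hexp]
  have hk : 0 ≤ (a * Z - m) ^ 2 / Z := div_nonneg (sq_nonneg _) hZ.le
  have he : (a * Z - m) ^ 2 / Z = a ^ 2 * Z - 2 * a * m + m ^ 2 / Z := by field_simp; ring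
  linarith

/-- ★★ **POINCARÉ INEQUALITIES TRANSFER UNDER ONE-SIDED COMPARISON.**  On the support `S` of `g`: if `Θ²w ≤ C_ν·D` (`C_ν ≥ 0`), `c_J·J₀ ≤ ΘMΘ` everywhere (`c_J > 0`, `J₀ ≥ 0`), the flat
reference pair `(D, J₀)` satisfies the Poincaré inequality `∫_S g²D − (∫_S gD)²/∫_S D ≤ P₀·½∫∫(g(x)−g(y))²J₀(x,y)` (`P₀ ≥ 0`), and `∫_S D > 0`, `∫_S Θ²w > 0`, then
(no sign condition on `J₀` is needed: `c_J·J₀ ≤ ΘMΘ` is used only against the non-negative weights `(g(x) − g(y))²`)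
`∫ g²Θ²w − (∫ gΘ²w)²/∫_S Θ²w ≤ (C_ν·P₀/c_J)·½∫∫(g(x)−g(y))²Θ(x)M(x,y)Θ(y)`. [folklore] -/
theorem variance_le_of_comparison (hM : Measurable (Function.uncurry M)) (hMb : ∀ x y, |M x y| ≤ CM) (hΘ : Measurable Θ) (hΘb : ∀ x, |Θ x| ≤ CΘ)
    (hg : Measurable g) (hgb : ∀ x, |g x| ≤ Cg) (hgS : ∀ x, x ∉ S → g x = 0) (hw : Measurable w) (hwb : ∀ x, |w x| ≤ Cw)
    (hD : Measurable D) (hDb : ∀ x, |D x| ≤ CD) (hJ₀ : Measurable (Function.uncurry J₀)) (hJ₀b : ∀ x y, |J₀ x y| ≤ CJ)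
    (hS : MeasurableSet S) (hν : ∀ x ∈ S, Θ x ^ 2 * w x ≤ Cν * D x) (hCν : 0 ≤ Cν) (hJ : ∀ x y, cJ * J₀ x y ≤ Θ x * M x y * Θ y) (hcJ : 0 < cJ) (hP₀ : 0 ≤ P₀)
    (hZ : 0 < ∫ x in S, Θ x ^ 2 * w x ∂μ) (hZD : 0 < ∫ x in S, D x ∂μ)
    (hflat : (∫ x in S, g x ^ 2 * D x ∂μ) - (∫ x in S, g x * D x ∂μ) ^ 2 / (∫ x in S, D x ∂μ) ≤ P₀ * ((1 / 2) * ∫ x, ∫ y, (g x - g y) ^ 2 * J₀ x y ∂μ ∂μ)) :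
    (∫ x, g x ^ 2 * (Θ x ^ 2 * w x) ∂μ) - (∫ x, g x * (Θ x ^ 2 * w x) ∂μ) ^ 2 / (∫ x in S, Θ x ^ 2 * w x ∂μ) ≤
      (Cν * P₀ / cJ) * ((1 / 2) * ∫ x, ∫ y, (g x - g y) ^ 2 * (Θ x * M x y * Θ y) ∂μ ∂μ) := by
  -- the weight `ν = Θ²w`
  have hν_m : Measurable fun x => Θ x ^ 2 * w x := (hΘ.pow_const 2).mul hw
  have hν_b : ∀ x, |Θ x ^ 2 * w x| ≤ CΘ ^ 2 * Cw := fun x => by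
    rw [abs_mul, abs_pow]; exact mul_le_mul (pow_le_pow_left₀ (abs_nonneg _) (hΘb x) 2) (hwb x) (abs_nonneg _) (sq_nonneg _)
  have hCg : ∀ z, 0 ≤ Cg := fun z => (abs_nonneg _).trans (hgb z)
  -- full integrals of `g`-weighted quantities are set integrals over `S`
  have eN : (∫ x, g x ^ 2 * (Θ x ^ 2 * w x) ∂μ) = ∫ x in S, g x ^ 2 * (Θ x ^ 2 * w x) ∂μ :=
    (setIntegral_eq_integral_of_forall_compl_eq_zero fun x hx => by simp [hgS x hx]).symm
  have em : (∫ x, g x * (Θ x ^ 2 * w x) ∂μ) = ∫ x in S, g x * (Θ x ^ 2 * w x) ∂μ :=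
    (setIntegral_eq_integral_of_forall_compl_eq_zero fun x hx => by simp [hgS x hx]).symm
  set a : ℝ := (∫ x in S, g x * D x ∂μ) / ∫ x in S, D x ∂μ with ha
  -- step (a): variance ≤ mean square deviation from the flat mean, in the `Θ²w` weight
  have h1 := variance_le_sq_dev (μ := μ) (S := S) hν_m hν_b hg hgb hZ a
  rw [← eN, ← em] at h1
  -- step (b): compare the weights on `S`
  have idev : ∀ {ρ : X → ℝ} {Cρ : ℝ}, Measurable ρ → (∀ x, |ρ x| ≤ Cρ) → Integrable (fun x => (g x - a) ^ 2 * ρ x) (μ.restrict S) := fun {ρ Cρ} hρ hρb =>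
    integrableOn_of_bdd ((( hg.sub measurable_const).pow_const 2).mul hρ) (C := (Cg + |a|) ^ 2 * Cρ) fun x => by
      rw [abs_mul, abs_pow]
      exact mul_le_mul (pow_le_pow_left₀ (abs_nonneg _) ((abs_sub (g x) a).trans (add_le_add_left (hgb x) _)) 2) (hρb x) (abs_nonneg _) (sq_nonneg _)
  have h2 : ∫ x in S, (g x - a) ^ 2 * (Θ x ^ 2 * w x) ∂μ ≤ ∫ x in S, Cν * ((g x - a) ^ 2 * D x) ∂μ := by
    refine setIntegral_mono_on (idev hν_m hν_b) ((idev hD hDb).const_mul Cν) hS fun x hx => ?_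
    have := hν x hx
    nlinarith [sq_nonneg (g x - a)]
  rw [integral_const_mul] at h2
  -- step (c): the flat mean square deviation is the flat variance
  have hsq : ∀ z, |g z ^ 2| ≤ Cg ^ 2 := fun z => by rw [abs_pow]; exact pow_le_pow_left₀ (abs_nonneg _) (hgb z) 2
  have iND : Integrable (fun x => g x ^ 2 * D x) (μ.restrict S) := integrableOn_of_bdd ((hg.pow_const 2).mul hD) (C := Cg ^ 2 * CD) fun x => by
    rw [abs_mul]; exact mul_le_mul (hsq x) (hDb x) (abs_nonneg _) (sq_nonneg _)
  have imD : Integrable (fun x => g x * D x) (μ.restrict S) := integrableOn_of_bdd (hg.mul hD) (C := Cg * CD) fun x => by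
    rw [abs_mul]; exact mul_le_mul (hgb x) (hDb x) (abs_nonneg _) (hCg x)
  have iZD : Integrable D (μ.restrict S) := integrableOn_of_bdd hD hDb
  have h3 : ∫ x in S, (g x - a) ^ 2 * D x ∂μ = (∫ x in S, g x ^ 2 * D x ∂μ) - (∫ x in S, g x * D x ∂μ) ^ 2 / (∫ x in S, D x ∂μ) := by
    have e : ∫ x in S, (g x - a) ^ 2 * D x ∂μ = ∫ x in S, ((g x ^ 2 * D x - (2 * a) * (g x * D x)) + a ^ 2 * D x) ∂μ :=
      integral_congr_ae (ae_of_all _ fun x => by ring)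
    have i1 : Integrable (fun x => g x ^ 2 * D x - (2 * a) * (g x * D x)) (μ.restrict S) := iND.sub (imD.const_mul _)
    have i2 : Integrable (fun x => a ^ 2 * D x) (μ.restrict S) := iZD.const_mul _
    rw [e, integral_add i1 i2, integral_sub iND (imD.const_mul _), integral_const_mul, integral_const_mul, ha]
    field_simp
    ring
  -- step (d): compare the jump forms
  have hdJ : Measurable (Function.uncurry fun x y => (g x - g y) ^ 2 * J₀ x y) := ((( hg.comp measurable_fst).sub (hg.comp measurable_snd)).pow_const 2).mul hJ₀
  have hdJb : ∀ x y, |(g x - g y) ^ 2 * J₀ x y| ≤ (2 * Cg) ^ 2 * CJ := fun x y => by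
    rw [abs_mul, abs_pow]
    exact mul_le_mul (pow_le_pow_left₀ (abs_nonneg _) ((abs_sub _ _).trans (by linarith [hgb x, hgb y])) 2) (hJ₀b x y) (abs_nonneg _) (sq_nonneg _)
  obtain ⟨-, -, -, m4⟩ := measurable_integrands (M := M) (g := g) hM hΘ hg
  have b4 := fun x y => (abs_integrands_le (M := M) hMb hΘb hgb x y).2.2.2
  have h4 : cJ * ∫ x, ∫ y, (g x - g y) ^ 2 * J₀ x y ∂μ ∂μ ≤ ∫ x, ∫ y, (g x - g y) ^ 2 * (Θ x * M x y * Θ y) ∂μ ∂μ := by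
    rw [integral_integral_eq_prod (μ := μ) hdJ hdJb, integral_integral_eq_prod (μ := μ) m4 b4, ← integral_const_mul]
    refine integral_mono ((integrable_prod_of_bdd (μ := μ) hdJ hdJb).const_mul cJ) (integrable_prod_of_bdd (μ := μ) m4 b4) fun p => ?_
    dsimp only [Function.uncurry]
    have := hJ p.1 p.2
    nlinarith [sq_nonneg (g p.1 - g p.2)]
  have h4' : ∫ x, ∫ y, (g x - g y) ^ 2 * J₀ x y ∂μ ∂μ ≤ (1 / cJ) * ∫ x, ∫ y, (g x - g y) ^ 2 * (Θ x * M x y * Θ y) ∂μ ∂μ := by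
    rw [one_div, ← div_eq_inv_mul]
    exact (le_div_iff₀' hcJ).mpr h4
  -- assemble
  calc (∫ x, g x ^ 2 * (Θ x ^ 2 * w x) ∂μ) - (∫ x, g x * (Θ x ^ 2 * w x) ∂μ) ^ 2 / (∫ x in S, Θ x ^ 2 * w x ∂μ)
      ≤ ∫ x in S, (g x - a) ^ 2 * (Θ x ^ 2 * w x) ∂μ := h1
    _ ≤ Cν * ∫ x in S, (g x - a) ^ 2 * D x ∂μ := h2
    _ = Cν * ((∫ x in S, g x ^ 2 * D x ∂μ) - (∫ x in S, g x * D x ∂μ) ^ 2 / (∫ x in S, D x ∂μ)) := by rw [h3]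
    _ ≤ Cν * (P₀ * ((1 / 2) * ∫ x, ∫ y, (g x - g y) ^ 2 * J₀ x y ∂μ ∂μ)) := mul_le_mul_of_nonneg_left hflat hCν
    _ ≤ Cν * (P₀ * ((1 / 2) * ((1 / cJ) * ∫ x, ∫ y, (g x - g y) ^ 2 * (Θ x * M x y * Θ y) ∂μ ∂μ))) :=
        mul_le_mul_of_nonneg_left (mul_le_mul_of_nonneg_left (mul_le_mul_of_nonneg_left h4' (by norm_num)) hP₀) hCν
    _ = (Cν * P₀ / cJ) * ((1 / 2) * ∫ x, ∫ y, (g x - g y) ^ 2 * (Θ x * M x y * Θ y) ∂μ ∂μ) := by ring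

end Comparison

/-! ## §4 ★★★ The door: upper quasimode + kernel lower comparison + flat Poincaré ⇒ the stiff bound -/

section Door

variable {M J₀ : X → X → ℝ} {Θ g w D : X → ℝ} {CM CΘ Cg Cw CD CJ : ℝ} {S : Set X} {η Λ Cν cJ P₀ : ℝ}

/-- ★★★ **THE (B-ST) DOOR.**  `M` symmetric bounded measurable; `Θ ≥ 0`, `w`, `g` bounded measurable, `g = 0` off the measurable set `S`; flat data `D` (weight) and `J₀` (jump kernel),
bounded measurable, with `∫_S D > 0`, `∫_S Θ²w > 0`.  HYPOTHESES: (Q) upper quasimode on `S`: `(MΘ)(x) ≤ (1+η)·Λ·Θ(x)w(x)` (`Λ > 0`); (ν) `Θ²w ≤ C_ν·D` on `S` (`C_ν > 0`);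
(J) `c_J·Λ·J₀ ≤ ΘMΘ` everywhere (`c_J > 0`); (P) flat Poincaré for `g`: `∫_S g²D − (∫_S gD)²/∫_S D ≤ P₀·½∫∫(g(x)−g(y))²J₀` (`P₀ > 0`).  CONCLUSION:
`∫∫ (gΘ)(x)M(x,y)(gΘ)(y) ≤ Λ·[(1 + η − c_J/(C_νP₀))·∫ g²Θ²w + (c_J/(C_νP₀))·(∫ gΘ²w)²/∫_S Θ²w]` — i.e. `θ₀ = c_J/(C_νP₀) − η`, up to the almost-orthogonality term.
[cite: Helffer2013, §7] -/
theorem form_le_of_quasimode_of_comparison (hM : Measurable (Function.uncurry M)) (hMb : ∀ x y, |M x y| ≤ CM) (hsymm : ∀ x y, M x y = M y x)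
    (hΘ : Measurable Θ) (hΘb : ∀ x, |Θ x| ≤ CΘ) (hΘ0 : ∀ x, 0 ≤ Θ x) (hg : Measurable g) (hgb : ∀ x, |g x| ≤ Cg) (hgS : ∀ x, x ∉ S → g x = 0)
    (hw : Measurable w) (hwb : ∀ x, |w x| ≤ Cw) (hD : Measurable D) (hDb : ∀ x, |D x| ≤ CD) (hJ₀ : Measurable (Function.uncurry J₀)) (hJ₀b : ∀ x y, |J₀ x y| ≤ CJ)
    (hS : MeasurableSet S) (hZ : 0 < ∫ x in S, Θ x ^ 2 * w x ∂μ) (hZD : 0 < ∫ x in S, D x ∂μ) (hΛ : 0 < Λ)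
    (hq : ∀ x ∈ S, ∫ y, M x y * Θ y ∂μ ≤ (1 + η) * Λ * (Θ x * w x)) (hν : ∀ x ∈ S, Θ x ^ 2 * w x ≤ Cν * D x) (hCν : 0 < Cν)
    (hJ : ∀ x y, cJ * (Λ * J₀ x y) ≤ Θ x * M x y * Θ y) (hcJ : 0 < cJ) (hP₀ : 0 < P₀)
    (hflat : (∫ x in S, g x ^ 2 * D x ∂μ) - (∫ x in S, g x * D x ∂μ) ^ 2 / (∫ x in S, D x ∂μ) ≤ P₀ * ((1 / 2) * ∫ x, ∫ y, (g x - g y) ^ 2 * J₀ x y ∂μ ∂μ)) :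
    ∫ x, ∫ y, (g x * Θ x) * M x y * (g y * Θ y) ∂μ ∂μ ≤
      Λ * ((1 + η - cJ / (Cν * P₀)) * ∫ x, g x ^ 2 * (Θ x ^ 2 * w x) ∂μ + (cJ / (Cν * P₀)) * ((∫ x, g x * (Θ x ^ 2 * w x) ∂μ) ^ 2 / ∫ x in S, Θ x ^ 2 * w x ∂μ)) := by
  -- the comparison with the kernel `Λ·J₀` and the constant `c_J`
  have hJΛ : Measurable (Function.uncurry fun x y => Λ * J₀ x y) := hJ₀.const_mul Λ
  have hJΛb : ∀ x y, |Λ * J₀ x y| ≤ |Λ| * CJ := fun x y => by rw [abs_mul]; exact mul_le_mul_of_nonneg_left (hJ₀b x y) (abs_nonneg _)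
  have hflat' : (∫ x in S, g x ^ 2 * D x ∂μ) - (∫ x in S, g x * D x ∂μ) ^ 2 / (∫ x in S, D x ∂μ) ≤
      (P₀ / Λ) * ((1 / 2) * ∫ x, ∫ y, (g x - g y) ^ 2 * (Λ * J₀ x y) ∂μ ∂μ) := by
    have e : ∫ x, ∫ y, (g x - g y) ^ 2 * (Λ * J₀ x y) ∂μ ∂μ = Λ * ∫ x, ∫ y, (g x - g y) ^ 2 * J₀ x y ∂μ ∂μ := by
      rw [← integral_const_mul]
      refine integral_congr_ae (ae_of_all _ fun x => ?_)
      dsimp only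
      rw [← integral_const_mul]
      refine integral_congr_ae (ae_of_all _ fun y => ?_); dsimp only; ring
    rw [e]
    calc _ ≤ P₀ * ((1 / 2) * ∫ x, ∫ y, (g x - g y) ^ 2 * J₀ x y ∂μ ∂μ) := hflat
      _ = (P₀ / Λ) * ((1 / 2) * (Λ * ∫ x, ∫ y, (g x - g y) ^ 2 * J₀ x y ∂μ ∂μ)) := by field_simp
  have hV := variance_le_of_comparison (μ := μ) (J₀ := fun x y => Λ * J₀ x y) hM hMb hΘ hΘb hg hgb hgS hw hwb hD hDb hJΛ hJΛb hS hν hCν.le hJ hcJ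
    (div_nonneg hP₀.le hΛ.le) hZ hZD hflat'
  -- Poincaré constant `P = C_ν (P₀/Λ)/c_J`, i.e. `Λ·Var ≤ (C_ν P₀/c_J)·½ jump`
  have hP : 0 < Cν * P₀ / cJ := div_pos (mul_pos hCν hP₀) hcJ
  have hPoinc : Λ * ((∫ x, g x ^ 2 * (Θ x ^ 2 * w x) ∂μ) - (∫ x, g x * (Θ x ^ 2 * w x) ∂μ) ^ 2 / ∫ x in S, Θ x ^ 2 * w x ∂μ) ≤
      (Cν * P₀ / cJ) * ((1 / 2) * ∫ x, ∫ y, (g x - g y) ^ 2 * (Θ x * M x y * Θ y) ∂μ ∂μ) := by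
    have h := mul_le_mul_of_nonneg_left hV hΛ.le
    calc _ ≤ Λ * ((Cν * (P₀ / Λ) / cJ) * ((1 / 2) * ∫ x, ∫ y, (g x - g y) ^ 2 * (Θ x * M x y * Θ y) ∂μ ∂μ)) := h
      _ = _ := by field_simp
  have h := form_le_of_quasimode_of_poincare (μ := μ) (η := η) hM hMb hsymm hΘ hΘb hΘ0 hg hgb hgS hw hwb hq hP hPoinc
  have e : 1 / (Cν * P₀ / cJ) = cJ / (Cν * P₀) := by field_simp
  rw [e] at h
  exact h

end Door

end Summit.QuantumFields.YangMills.Theorems.FemtoTransferGap.StiffDoor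

end
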